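import Literature.Geometry.Riemannian.ColdingMinicozziEntropy
import HarnessLib

/-!
# Entropy bounds area ratios: `𝓗ⁿ(Σ ∩ B_R(x₀)) ≤ e^{1/4} (4π)^{n/2} λ(Σ) Rⁿ` (Colding–Minicozzi 2012)

Topic `Literature/Geometry/Riemannian`; companion of `ColdingMinicozziEntropyFinite.lean` (which
proves the converse direction: Euclidean area growth on balls ⇒ `λ < ∞`). Everything here is
PROVED; no named facts.

The estimate is the first line of every local-regularity / compactness argument in the
mean-curvature-flow literature ("an entropy bound gives scale-invariant area bounds"). Printed
source, T. H. Colding, W. P. Minicozzi II, *Generic mean curvature flow I; generic singularities*,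
Ann. of Math. 175 (2012), held text `paper:arxiv-0908.3788`:

* proof of the volume bound for blow ups (Lemma 2.9 of the journal version; held text p. 9,
  "Volume bounds and a priori bounds for blow ups"):
  "`[4π(t₀-t)]^{-n/2} e^{-1/4} Vol(B_{√(t₀-t)}(x₀) ∩ M_t) ≤ [4π(t₀-t)]^{-n/2}
  ∫_{B_{√(t₀-t)}(x₀) ∩ M_t} e^{|x-x₀|²/(4(t-t₀))} ≤ ∫_{M_t} Φ_{x₀,t₀}(·,t)`";
* the section on self-shrinkers with bounded diameter (journal §8, proof of the compactness
  corollary; held text p. 25): "the bound on the entropy gives the scale-invariant area bound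
  `(4π)^{-1} e^{-1/4} Area(B_R(x₀) ∩ Σ)/R² ≤ (4πR²)^{-1} ∫_{B_R(x₀) ∩ Σ} e^{-|x-x₀|²/(4R²)}
  ≤ F_{x₀,R²}(Σ) ≤ λ̄`" (there `n = 2`).

In the tree's vocabulary (`ColdingMinicozziEntropy.lean`: `gaussianWeight p t x = e^{-‖x-p‖²/(4t)}`,
`gaussianNormalization n t = (4πt)^{-n/2}`, `gaussianMass`, `gaussianArea n p t A = F_{p,t}(A)` with
the area measure `μHE[n]`, `gaussianEntropy n A = λ(A)`), for every measure `μ`, set `A`, centre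
`p`, radius `R` and scale `t > 0`:

* `mul_measure_closedBall_le_gaussianMass` — `(4πt)^{-n/2} e^{-R²/(4t)} μ(B̄_R(p)) ≤ F_{p,t}(μ)`
  (the weight is `≥ e^{-R²/(4t)}` on the closed ball);
* `mul_measure_inter_closedBall_le_gaussianArea` — the same for `μ = 𝓗ⁿ⌊A`;
* `measure_inter_closedBall_le_mul_gaussianArea` — at the natural scale `t = R²`:
  `𝓗ⁿ(A ∩ B̄_R(p)) ≤ e^{1/4} (4π)^{n/2} Rⁿ · F_{p,R²}(A)`;
* `measure_inter_closedBall_le_mul_gaussianEntropy` — **the scale-invariant area bound**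
  `𝓗ⁿ(A ∩ B̄_R(p)) ≤ e^{1/4} (4π)^{n/2} Rⁿ · λ(A)`, for all `p` and `R > 0`; with
  `measure_inter_ball_le_mul_gaussianEntropy` for open balls.

Together with `ColdingMinicozziEntropyFinite.lean` this gives the standard equivalence
"`λ(Σ) < ∞` iff `Σ` has uniform Euclidean area ratios" for `𝓗ⁿ`-measurable `Σ`.

## References

* [ColdingMinicozzi2012] T. H. Colding, W. P. Minicozzi II, Ann. of Math. 175 (2012) 755–833:
  Lemma 2.9 and its proof (2.10)–(2.11); §8, proof of Cor. 8.2 (the scale-invariant area bound).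
* [ChodoshMantoulidisSchulze2025] O. Chodosh, C. Mantoulidis, F. Schulze, Duke Math. J. (2025),
  arXiv:2309.03856, §2 (area ratio bounds from entropy in the parabolic covering arguments).
-/

noncomputable section

open MeasureTheory MeasureTheory.Measure Set Metric
open scoped ENNReal NNReal Topology

namespace Literature.Geometry.Riemannian

variable {E : Type*} [NormedAddCommGroup E] [MeasurableSpace E] [BorelSpace E]

omit [MeasurableSpace E] [BorelSpace E] in
/-- On the closed ball `B̄_R(p)` the Gaussian weight is at least `e^{-R²/(4t)}` (`t > 0`).
[cite: ColdingMinicozzi2012, proof of Lemma 2.9, (2.10)] -/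
theorem exp_le_gaussianWeight_of_mem_closedBall (p : E) {t : ℝ} (ht : 0 < t) {R : ℝ} {x : E}
    (hx : x ∈ closedBall p R) :
    ENNReal.ofReal (Real.exp (-(R ^ 2) / (4 * t))) ≤ gaussianWeight p t x := by
  unfold gaussianWeight
  refine ENNReal.ofReal_le_ofReal (Real.exp_le_exp.2 ?_)
  rw [mem_closedBall, dist_eq_norm] at hx
  have h4t : 0 < 4 * t := by positivity
  rw [neg_div, neg_div, neg_le_neg_iff, div_le_div_iff_of_pos_right h4t]
  exact pow_le_pow_left₀ (norm_nonneg _) hx 2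

/-- **`(4πt)^{-n/2} e^{-R²/(4t)} μ(B̄_R(p)) ≤ F_{p,t}(μ)`** for every measure `μ`, `t > 0`.
[cite: ColdingMinicozzi2012, proof of Lemma 2.9, (2.10)] -/
theorem mul_measure_closedBall_le_gaussianMass (n : ℕ) (p : E) {t : ℝ} (ht : 0 < t) (R : ℝ)
    (μ : Measure E) :
    gaussianNormalization n t * (ENNReal.ofReal (Real.exp (-(R ^ 2) / (4 * t))) *
      μ (closedBall p R)) ≤ gaussianMass n p t μ := by
  unfold gaussianMass
  gcongr
  calc ENNReal.ofReal (Real.exp (-(R ^ 2) / (4 * t))) * μ (closedBall p R)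
      = ∫⁻ _ in closedBall p R, ENNReal.ofReal (Real.exp (-(R ^ 2) / (4 * t))) ∂μ := by
        rw [setLIntegral_const]
    _ ≤ ∫⁻ x in closedBall p R, gaussianWeight p t x ∂μ :=
        setLIntegral_mono (measurable_gaussianWeight p t) fun x hx =>
          exp_le_gaussianWeight_of_mem_closedBall p ht hx
    _ ≤ ∫⁻ x, gaussianWeight p t x ∂μ := setLIntegral_le_lintegral _ _

/-- **`(4πt)^{-n/2} e^{-R²/(4t)} 𝓗ⁿ(A ∩ B̄_R(p)) ≤ F_{p,t}(A)`**, `t > 0`.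
[cite: ColdingMinicozzi2012, proof of Lemma 2.9, (2.10)] -/
theorem mul_measure_inter_closedBall_le_gaussianArea (n : ℕ) (p : E) {t : ℝ} (ht : 0 < t)
    (R : ℝ) (A : Set E) :
    gaussianNormalization n t * (ENNReal.ofReal (Real.exp (-(R ^ 2) / (4 * t))) *
      (μHE[n] : Measure E) (A ∩ closedBall p R)) ≤ gaussianArea n p t A := by
  have h := mul_measure_closedBall_le_gaussianMass n p ht R ((μHE[n] : Measure E).restrict A)
  rwa [Measure.restrict_apply measurableSet_closedBall, inter_comm] at h

/-- The constant of the scale-invariant area bound: `(4πR²)^{-n/2} e^{-1/4}` is the reciprocal of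
`e^{1/4} (4π)^{n/2} Rⁿ` (`R > 0`). [folklore] -/
theorem gaussianNormalization_sq_mul_exp (n : ℕ) {R : ℝ} (hR : 0 < R) :
    gaussianNormalization n (R ^ 2) * ENNReal.ofReal (Real.exp (-(R ^ 2) / (4 * R ^ 2))) =
      (ENNReal.ofReal (Real.exp (1 / 4) * (4 * Real.pi) ^ ((n : ℝ) / 2) * R ^ n))⁻¹ := by
  have hR2 : 0 < R ^ 2 := by positivity
  have hexp : -(R ^ 2) / (4 * R ^ 2) = -(1 / 4) := by
    field_simp
  have hc : 0 < Real.exp (1 / 4) * (4 * Real.pi) ^ ((n : ℝ) / 2) * R ^ n := by positivity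
  have hRn : (R ^ 2) ^ ((n : ℝ) / 2) = R ^ n := by
    rw [← Real.rpow_natCast R 2, ← Real.rpow_mul hR.le]
    push_cast
    rw [show (2 : ℝ) * ((n : ℝ) / 2) = (n : ℝ) by ring, Real.rpow_natCast]
  have key : (4 * Real.pi * R ^ 2) ^ (-(n : ℝ) / 2) * Real.exp (-(1 / 4)) =
      (Real.exp (1 / 4) * (4 * Real.pi) ^ ((n : ℝ) / 2) * R ^ n)⁻¹ := by
    rw [neg_div, Real.rpow_neg (by positivity), Real.exp_neg,
      Real.mul_rpow (by positivity) hR2.le, hRn, mul_inv, mul_inv, mul_inv]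
    ring
  rw [hexp, gaussianNormalization, ← ENNReal.ofReal_mul (Real.rpow_nonneg (by positivity) _), key,
    ENNReal.ofReal_inv_of_pos hc]

/-- **Area ratio bound at the natural scale**: `𝓗ⁿ(A ∩ B̄_R(p)) ≤ e^{1/4} (4π)^{n/2} Rⁿ · F_{p,R²}(A)`
for `R > 0`. [cite: ColdingMinicozzi2012, §8, proof of Cor. 8.2] -/
theorem measure_inter_closedBall_le_mul_gaussianArea (n : ℕ) (p : E) {R : ℝ} (hR : 0 < R)
    (A : Set E) :
    (μHE[n] : Measure E) (A ∩ closedBall p R) ≤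
      ENNReal.ofReal (Real.exp (1 / 4) * (4 * Real.pi) ^ ((n : ℝ) / 2) * R ^ n) *
        gaussianArea n p (R ^ 2) A := by
  have h := mul_measure_inter_closedBall_le_gaussianArea n p (by positivity : 0 < R ^ 2) R A
  rw [← mul_assoc, gaussianNormalization_sq_mul_exp n hR] at h
  have hc : ENNReal.ofReal (Real.exp (1 / 4) * (4 * Real.pi) ^ ((n : ℝ) / 2) * R ^ n) ≠ 0 :=
    (ENNReal.ofReal_pos.2 (by positivity)).ne'
  calc (μHE[n] : Measure E) (A ∩ closedBall p R)
      = ENNReal.ofReal (Real.exp (1 / 4) * (4 * Real.pi) ^ ((n : ℝ) / 2) * R ^ n) *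
          ((ENNReal.ofReal (Real.exp (1 / 4) * (4 * Real.pi) ^ ((n : ℝ) / 2) * R ^ n))⁻¹ *
            (μHE[n] : Measure E) (A ∩ closedBall p R)) := by
        rw [← mul_assoc, ENNReal.mul_inv_cancel hc ENNReal.ofReal_ne_top, one_mul]
    _ ≤ _ := by gcongr

/-- **The scale-invariant area bound from the entropy** (Colding–Minicozzi 2012): for every set
`A`, centre `p` and radius `R > 0`,
`𝓗ⁿ(A ∩ B̄_R(p)) ≤ e^{1/4} (4π)^{n/2} Rⁿ · λ(A)`; in particular a set of finite entropy has
uniformly Euclidean area growth. [cite: ColdingMinicozzi2012, §8, proof of Cor. 8.2; Lemma 2.9] -/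
theorem measure_inter_closedBall_le_mul_gaussianEntropy (n : ℕ) (A : Set E) (p : E) {R : ℝ}
    (hR : 0 < R) :
    (μHE[n] : Measure E) (A ∩ closedBall p R) ≤
      ENNReal.ofReal (Real.exp (1 / 4) * (4 * Real.pi) ^ ((n : ℝ) / 2) * R ^ n) *
        gaussianEntropy n A :=
  (measure_inter_closedBall_le_mul_gaussianArea n p hR A).trans <|
    mul_le_mul' le_rfl (gaussianArea_le_gaussianEntropy n p (by positivity) A)

/-- The scale-invariant area bound for open balls: `𝓗ⁿ(A ∩ B_R(p)) ≤ e^{1/4} (4π)^{n/2} Rⁿ · λ(A)`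
(`R > 0`). [cite: ColdingMinicozzi2012, §8, proof of Cor. 8.2; Lemma 2.9] -/
theorem measure_inter_ball_le_mul_gaussianEntropy (n : ℕ) (A : Set E) (p : E) {R : ℝ}
    (hR : 0 < R) :
    (μHE[n] : Measure E) (A ∩ ball p R) ≤
      ENNReal.ofReal (Real.exp (1 / 4) * (4 * Real.pi) ^ ((n : ℝ) / 2) * R ^ n) *
        gaussianEntropy n A :=
  (measure_mono (inter_subset_inter_right A ball_subset_closedBall)).trans
    (measure_inter_closedBall_le_mul_gaussianEntropy n A p hR)

/-- **Finite entropy ⇒ uniform Euclidean area ratios**: if `λ(A) < ∞` there is `V < ∞` with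
`𝓗ⁿ(A ∩ B̄_R(p)) ≤ V Rⁿ` for all centres `p` and radii `R > 0` (namely
`V = e^{1/4} (4π)^{n/2} λ(A)`). [cite: ColdingMinicozzi2012, Lemma 2.9] -/
theorem exists_measure_inter_closedBall_le_of_gaussianEntropy_lt_top (n : ℕ) {A : Set E}
    (hA : gaussianEntropy n A < ∞) :
    ∃ V : ℝ≥0∞, V < ∞ ∧ ∀ (p : E) (R : ℝ), 0 < R →
      (μHE[n] : Measure E) (A ∩ closedBall p R) ≤ V * ENNReal.ofReal (R ^ n) := by
  refine ⟨ENNReal.ofReal (Real.exp (1 / 4) * (4 * Real.pi) ^ ((n : ℝ) / 2)) * gaussianEntropy n A,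
    ENNReal.mul_lt_top ENNReal.ofReal_lt_top hA, fun p R hR => ?_⟩
  calc (μHE[n] : Measure E) (A ∩ closedBall p R)
      ≤ ENNReal.ofReal (Real.exp (1 / 4) * (4 * Real.pi) ^ ((n : ℝ) / 2) * R ^ n) *
          gaussianEntropy n A := measure_inter_closedBall_le_mul_gaussianEntropy n A p hR
    _ = ENNReal.ofReal (Real.exp (1 / 4) * (4 * Real.pi) ^ ((n : ℝ) / 2)) * gaussianEntropy n A *
          ENNReal.ofReal (R ^ n) := by
        rw [ENNReal.ofReal_mul (by positivity)]
        ring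

end Literature.Geometry.Riemannian

end
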